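import Summits.BirchSwinnertonDyer.Rank1Residual.X11b.Three.HsiehDescentOfRangeReciprocity
import HarnessLib

/-!
# Route `ClassRecordThree` — objects the route posits (Defs): the SHARP value-reciprocity clause
# (VR-B_U)|κ at `p = 3`, the layer-2 crux of item 19108 `HsiehDescentAtThree`

Cell `bsd-stepL` (run/shared/lean/pub/bsd-stepL/), seat `bsd-stepL-bdp` (prover g10), D-0059 rung-K2@3 routes
`route-BirchSwinnertonDyer-ClassRecordThree` ∕ `-KolyvaginRoadThree` (shared item stmt-BirchSwinnertonDyer-19108);
planner g23's split plan `plan/D0059/split-19108/` asks for this def BY NAME. This module imports NO Theses file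
(route files may import it: no glue.cyclic-import).

ONE definition, NOTHING asserted: `ValueReciprocityBAtThree W` is, VERBATIM, the per-curve hypothesis `hVR` of the
landed sharp reduction `BdpSeat.hsiehDescentAt₃_of_sharpValueReciprocity_of_tateSenCharacter`
(`Theorems/ClassRecordThreeHsiehDescentSharp.lean`): for every datum of the node `Three.HsiehDescentAt₃ W` —
`ι′ : ℚ̄₃ ≃ ℂ`; `K` imaginary quadratic with `d_K` ODD satisfying the Heegner hypothesis for `N = N_E`; `3` split in
`K`; `𝔭 ∣ 3` of degree one induced by `ι′`; `κ` an anticyclotomic `ℤ₃`-extension; `f` the newform of `E`; `(E,3)`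
in class X11b (`r_an = 1`, `3 ∥ N`, `E[3]` irreducible) with `ρ̄_{E,3}` onto — there are `Ω ∈ ℂ^×` and `m ≥ 1`,
`3 ∤ m`, such that for every `τ ∈ Gal(ℚ̄₃/ℚ₃(μ_m))`, every `σ ∈ Aut(ℂ/ℚ)` lying over `τ` (`σ ∘ ι′ = ι′ ∘ τ` on
`ℚ̄₃`) and every everywhere-unramified Hecke character `χ` of `K` of infinity type `(n, −n)`, `n > 0`, whose
`3`-adic avatar factors through `κ`, Castella's interpolation value
`V(χ) = bdpInterpolationValue 3 f 𝔭 χ n Ω = Γ(n)Γ(n+1)·(1 − a₃ 3⁻¹ χ(𝔭))²·L(f/K, χ, 1)/(π^{2n+1} Ω^{4n})`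
satisfies EXACT reciprocity `σ(V(χ)) = V(χ^σ)` (`χ^σ = HasInfinityType.autConj`, Weil's conjugate character).

WHY THIS SHAPE («K5-B», PROOF-BDP §18; x11b3 LIT-TABLE L72 (β) ∕ L90 (E)). It is the print-derivable form of the
archimedean value-reciprocity input of the `R₀`-descent at `3 ∥ N`: for `σ ∈ Aut(ℂ/H(i))` (`H` the Hilbert
class field of `K`), with `Ω = Ω_K` the CM period, the algebraic parts `V(χ)` are EXACTLY `σ`-equivariant by
[T1] Bertolini–Darmon–Prasanna 2013 (Prop. 1.12 (1), display (5.1.16), Thm. 5.4 — Waldspurger's formula as the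
square of a CM value of `δ^n f`, standing hypothesis `c·d_K` ODD — and Lemma 5.3) together with [T2] the
Shimura–Katz rationality of CM values of nearly holomorphic forms in its functorial form (Katz 1978 (2.4.5) as
restated by Hida–Tilouine 1993 Thm. 1.1; Brooks 2015 Def. 3.2 (1) for the base-change axiom); since `H(i)/ℚ` is
unramified above `3` (`3` split in `K`, `H/K` unramified), `ι′⁻¹H(i)` lies in some `ℚ₃(μ_m)` with `3 ∤ m`, so every
`σ` over a `τ` fixing `μ_m` fixes `H(i)`. The assembled `σ`-statement itself is printed nowhere (x11b3 L72 (α));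
hence a CRUX, not a Literature fact. All hypotheses of the node are threaded (in particular `Odd (discr K)`,
which [T1] needs), so nothing stronger than the print-derivable statement is posited; the unsharp predecessor
(binder `hVRBU` of `Theorems/ClassRecordThreeHsiehDescentOfOpenReciprocity.lean`, p416145) omits four of them.

CONSUMER: `TateSenCharacterVanishing 3 → (∀ W, ValueReciprocityBAtThree W) → Theses.ClassRecordThree.HsiehDescentAtThree`
(`Theorems/ClassRecordThreeHsiehDescentOfValueReciprocityB.lean`, by the sharp reduction). HONEST FRAMING: a
statement only; item 19108 and the node stay OPEN; no class of atom O2@3, no census word.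

References: [BertoliniDarmonPrasanna2013] M. Bertolini, H. Darmon, K. Prasanna, Duke Math. J. 162 (2013), Prop.
1.12 (1), (5.1.16), Lemma 5.3, Thm. 5.4; [HidaTilouine1993] H. Hida, J. Tilouine, Ann. Sci. ÉNS 26 (1993) Thm.
1.1; [Castella2018] Thm. 3.1 (the value `V(χ)`); [CastellaHsieh2018] Def. 3.5, Prop. 3.6; [Hsieh2014] Thm. 1.
-/

namespace Summit.BirchSwinnertonDyer.BirchSwinnertonDyer.Theorems

open NumberField IsDedekindDomain WeierstrassCurve
open Literature.NumberTheory.GaloisRepresentations Literature.NumberTheory.EllipticCurves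
  Literature.NumberTheory.EllipticCurves.ModularForms
open Literature.NumberTheory.EllipticCurves.Rank1Residual (Surj)
open Summit.BirchSwinnertonDyer.Rank1Residual

/-- **`ValueReciprocityBAtThree W` — the SHARP value-reciprocity clause (VR-B_U)|κ at `p = 3` («K5-B»).** For every
datum of `Three.HsiehDescentAt₃ W` (`ι′ : ℚ̄₃ ≃ ℂ`; `K` imaginary quadratic, `d_K` odd, Heegner hypothesis for
`N = N_E`; `3` split; `𝔭 ∣ 3` of degree one induced by `ι′`; (Heeg) clause; `κ` anticyclotomic; `f` the newform
of `E`; `ClassX11b W 3`, `Surj W 3`): `∃ Ω ≠ 0, ∃ m ≥ 1, 3 ∤ m`, such that for all `τ` fixing `μ_m`, all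
`σ ∈ Aut(ℂ/ℚ)` over `τ`, all everywhere-unramified `χ` of infinity type `(n, −n)`, `n > 0`, with `3`-adic
avatar factoring through `κ`: `σ (bdpInterpolationValue 3 f 𝔭 χ n Ω) = bdpInterpolationValue 3 f 𝔭 χ^σ n Ω`.
VERBATIM the hypothesis `hVR` of `BdpSeat.hsiehDescentAt₃_of_sharpValueReciprocity_of_tateSenCharacter`.
Print-derivable (for `σ ∈ Aut(ℂ/H(i))`, `Ω = Ω_K`) from [T1] + [T2] below; the assembled statement is printed
nowhere, so it is a route object (crux), NOT a named fact; nothing is asserted.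
[cite: BertoliniDarmonPrasanna2013, Thm. 5.4 and Lemma 5.3 (shape of the reciprocity; standing hypothesis c·d_K odd)]
[cite: HidaTilouine1993, Thm. 1.1 (p. 200) (Shimura–Katz rationality of CM values, functorial form)]
[cite: Castella2018, Thm. 3.1 (arXiv:1704.06608 p. 9) (the interpolation value V(χ))] -/
@[conjecture]
def ValueReciprocityBAtThree (W : WeierstrassCurve ℚ) [W.IsElliptic] [W.IsGloballyMinimal] : Prop :=
  ∀ (ι' : PadicAlgCl 3 ≃+* ℂ) (K : Type) [Field K] [NumberField K] (𝔭 : HeightOneSpectrum (𝓞 K))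
      (κ : ZpExtension K 3) {N : ℕ} [NeZero N] (f : CuspForm (CongruenceSubgroup.Gamma0 N) 2),
      IsNewformOf W f → ClassX11b W 3 → Surj W 3 → W.conductorNorm ℤ = N → IsImaginaryQuadratic K →
      Odd (NumberField.discr K) → SatisfiesHeegnerHypothesis N K →
      ((Ideal.span {(3 : ℤ)}).primesOver (𝓞 K)).ncard = 2 → ((3 : ℕ) : 𝓞 K) ∈ 𝔭.asIdeal →
      𝔭.asIdeal.ramificationIdx (𝓞 ℚ) = 1 → 𝔭.asIdeal.inertiaDeg (𝓞 ℚ) = 1 →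
      (∀ (w : InfinitePlace K) (k : 𝓞 K), k ∈ 𝔭.asIdeal ↔ ‖ι'.symm (w.embedding (k : K))‖ < 1) →
      (∀ ℓ : ℕ, ℓ.Prime → ℓ ∣ N → ∃ v : HeightOneSpectrum (𝓞 K), Ideal.absNorm v.asIdeal = ℓ) →
      κ.IsAnticyclotomic →
      ∃ Ω : ℂ, Ω ≠ 0 ∧ ∃ m : ℕ, 0 < m ∧ ¬ 3 ∣ m ∧
        (∀ (τ : PadicAlgCl 3 ≃ₐ[ℚ_[3]] PadicAlgCl 3) (σ : ℂ ≃ₐ[ℚ] ℂ),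
          (∀ ζ : PadicAlgCl 3, ζ ^ m = 1 → τ ζ = ζ) →
          (∀ z : PadicAlgCl 3, σ (ι' z) = ι' (τ z)) →
          ∀ (χ : HeckeCharacter K) (n : ℕ), 0 < n →
            (∀ v : HeightOneSpectrum (𝓞 K), χ.IsUnramifiedAt v) →
            ∀ hχ : χ.HasInfinityType (fun _ ↦ (n : ℤ)) (fun _ ↦ -(n : ℤ)),
              ∀ r : FramedGaloisRep K (PadicAlgCl 3) 1, IsPAdicAvatarOf ι' χ r → FactorsThroughZp κ r →
                σ (bdpInterpolationValue 3 f 𝔭 χ n Ω) =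
                  bdpInterpolationValue 3 f 𝔭 (hχ.autConj σ) n Ω)

end Summit.BirchSwinnertonDyer.BirchSwinnertonDyer.Theorems
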